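import Literature.Combinatorics.Sahi2008.PushForward
import Literature.Probability.Percolation.PositiveAssociation
import Literature.Probability.LatticeModels.ProdBernoulliIndependence
import Literature.Probability.LatticeModels.ProdBernoulliWeightContinuity
import HarnessLib

/-!
# Kahn (2022), footnote 2: FUI does NOT imply FKG — the law of `(Y₁Y₂, Y₁Y₃, Y₂Y₃)`

CITATION HEADER.  Source: J. Kahn, *A note on positive association*, arXiv:2210.08653 (2022) [Kahn2022],
p. 2, read from the materialised arXiv text.  Context (p. 2, verbatim): "Underlying independents. One way to
prove PA for `µ` is to realize the `X_i`'s as increasing functions of independent Bernoullis `Y_1,…,Y_m` and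
invoke Harris; more generally, `µ` is PA if it is a limit of measures obtained in this way.  Say `µ` is FUI
(for finitely many underlying independents) in the first case, and UI in the second.  This is not as
restrictive as it sounds, since FKG measures are FUI,¹ ²"; footnote 2 (verbatim): "**For completeness we
note that FUI does not imply FKG.  E.g. with `Y_1, Y_2, Y_3` independent Bernoullis, let `X_1 = Y_1Y_2`,
`X_2 = Y_1Y_3`, and `X_3 = Y_2Y_3`, and notice that the law of the `X_i`'s assigns probability zero to
strings of weight 2, so trivially violates (1)**" — (1) being the positive lattice condition
`µ(x)µ(y) ≤ µ(x ∧ y)µ(x ∨ y)` of p. 1 ("A `µ` satisfying (1) … is an FKG measure").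

What is here (everything PROVED; three small `def`s at each level, no named fact).  Coordinates are
`0, 1, 2`; Kahn's pairs are `fn2Pair = ((0,1), (0,2), (1,2))`, i.e. `X_i = Y_{a_i} Y_{b_i}`.  The coins are
arbitrary NON-DEGENERATE ones, `0 < q_i < 1` (with a degenerate coin the law can be a point mass, which is
FKG; Kahn's "independent Bernoullis" are implicitly non-degenerate).

* WEIGHT LEVEL (the vocabulary of `UnderlyingIndependents.lean`, where "FKG measures are FUI" is the theorem
  `IsFKGMeasure.exists_coinRepresentation_cube : IsFKGMeasure μ → ∃ m q G, q ∈ (0,1)^m ∧ Monotone G ∧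
  μ = G_* (coinWeight q)` on the cube `Fin k → Bool`): `Kahn2022.pairProd` (the monotone map
  `y ↦ (y_0 y_1, y_0 y_2, y_1 y_2)`), `Kahn2022.fn2Weight q = pairProd_* (coinWeight q)` (the law of the
  `X`'s), **`Kahn2022.fn2Weight_eq_zero_of_weightTwo`** ("probability zero to strings of weight 2"),
  **`Kahn2022.not_isFKGMeasure_fn2Weight`** ("violates (1)": at `x = 100`, `y = 010`), and the packaged
  converse failure **`Kahn2022.kahn2022_fn2`**: there is a probability weight on `{0,1}^3` of the form
  `G_* (coinWeight q)` with `q` non-degenerate and `G` monotone (FUI) which is NOT `IsFKGMeasure`.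
* MEASURE LEVEL (the vocabulary of `KahnFixedPointExample.lean`, where Corollary 4 "PA ⇏ FUI" is
  `Kahn2022.kahn2022_cor4` with FUI = `(prodBernoulli q).map Φ`, `Φ` monotone): `Kahn2022.pairMap`
  (`S ↦ {i | a_i ∈ S ∧ b_i ∈ S}` on `Set (Fin 3)`), `Kahn2022.fn2Law q = (prodBernoulli q).map pairMap`, a
  probability measure, **positively associated** (`isPositivelyAssociated_fn2Law`: FUI ⇒ PA by Harris,
  `isPositivelyAssociated_prodBernoulli`, and `IsPositivelyAssociated.map`), giving mass `0` to the three
  2-sets (`fn2Law_real_pair_eq_zero`) and violating the lattice condition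
  (**`not_isFKGMeasure_fn2Law`**); packaged as **`Kahn2022.kahn2022_fn2_measure`**.

With `UnderlyingIndependents.lean` (FKG ⇒ FUI), Harris (FUI ⇒ PA) and `KahnFixedPointExample.lean`
(PA ⇏ FUI, Kahn's Corollary 4) this makes both inclusions of the chain FKG ⊊ FUI ⊊ PA strict in the tree,
each with Kahn's printed witness.

## References
* J. Kahn, *A note on positive association*, arXiv:2210.08653 (2022), p. 2 footnote 2; p. 1 eq. (1). [Kahn2022]
-/

noncomputable section

open MeasureTheory Measure Set
open Literature.Probability.LatticeModels (prodBernoulli prodBernoulli_harris prodBernoulli_real_pos_of_nonempty)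
open Literature.Probability.Percolation (IsPositivelyAssociated isPositivelyAssociated_of_real)

namespace Literature.Combinatorics.Sahi2008

namespace Kahn2022

/-! ### Kahn's three pairs -/

/-- Kahn's index pairs, `0`-indexed: `X_1 = Y_1Y_2`, `X_2 = Y_1Y_3`, `X_3 = Y_2Y_3` become
`X_0 = Y_0Y_1`, `X_1 = Y_0Y_2`, `X_2 = Y_1Y_2`. [cite: Kahn2022, p. 2 footnote 2] -/
def fn2Pair : Fin 3 → Fin 3 × Fin 3
  | 0 => (0, 1)
  | 1 => (0, 2)
  | 2 => (1, 2)

/-- The values of `fn2Pair`, for `simp`. [cite: Kahn2022, p. 2 footnote 2] -/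
@[simp] theorem fn2Pair_zero : fn2Pair 0 = (0, 1) := rfl
/-- The values of `fn2Pair`, for `simp`. [cite: Kahn2022, p. 2 footnote 2] -/
@[simp] theorem fn2Pair_one : fn2Pair 1 = (0, 2) := rfl
/-- The values of `fn2Pair`, for `simp`. [cite: Kahn2022, p. 2 footnote 2] -/
@[simp] theorem fn2Pair_two : fn2Pair 2 = (1, 2) := rfl

/-! ### Weight level: the cube `Fin 3 → Bool` -/

section Weight

/-- **The map `Y ↦ X`**: `(pairProd y)_i = y_{a_i} ∧ y_{b_i}`, i.e. `X_0 = Y_0Y_1`, `X_1 = Y_0Y_2`,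
`X_2 = Y_1Y_2` as Boolean products. [cite: Kahn2022, p. 2 footnote 2] -/
def pairProd (y : Fin 3 → Bool) : Fin 3 → Bool := fun i => y (fn2Pair i).1 && y (fn2Pair i).2

/-- `pairProd` is monotone (products of increasing functions of the coins are increasing) — so its law is
FUI by definition. [cite: Kahn2022, p. 2 footnote 2 and "Underlying independents"] -/
theorem pairProd_mono : Monotone pairProd := by
  intro y y' h i
  have h1 := h (fn2Pair i).1
  have h2 := h (fn2Pair i).2
  rw [Bool.le_iff_imp] at h1 h2 ⊢
  simp only [pairProd, Bool.and_eq_true]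
  exact fun hy => ⟨h1 hy.1, h2 hy.2⟩

/-- **The law of `(X_0, X_1, X_2)`**: the push-forward of the coin weight `coinWeight q` (independent
Bernoullis `Y_0, Y_1, Y_2` with `P(Y_i = 1) = q_i`) along `pairProd`. [cite: Kahn2022, p. 2 footnote 2] -/
def fn2Weight (q : Fin 3 → ℝ) : (Fin 3 → Bool) → ℝ := pushWeight (coinWeight q) pairProd

/-- The law is a nonnegative weight (for `q ∈ [0,1]^3`). [cite: Kahn2022, p. 2 footnote 2] -/
theorem fn2Weight_nonneg {q : Fin 3 → ℝ} (hq : ∀ i, 0 ≤ q i ∧ q i ≤ 1) (x : Fin 3 → Bool) :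
    0 ≤ fn2Weight q x :=
  pushWeight_nonneg (coinWeight_nonneg hq) _ _

/-- The law has total mass one. [cite: Kahn2022, p. 2 footnote 2] -/
theorem sum_fn2Weight (q : Fin 3 → ℝ) : ∑ x, fn2Weight q x = 1 := by
  rw [fn2Weight, sum_pushWeight, sum_coinWeight]

/-- No outcome of `pairProd` has weight exactly two: if two of the products `Y_aY_b` are `1` then all three
coins are `1` and so is the third product. [cite: Kahn2022, p. 2 footnote 2] -/
theorem pairProd_ne_of_weightTwo {x : Fin 3 → Bool}
    (hx : (Finset.univ.filter fun i => x i = true).card = 2) (y : Fin 3 → Bool) : pairProd y ≠ x := by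
  revert y x
  decide

/-- **"The law of the `X_i`'s assigns probability zero to strings of weight 2."**
[cite: Kahn2022, p. 2 footnote 2] -/
theorem fn2Weight_eq_zero_of_weightTwo (q : Fin 3 → ℝ) {x : Fin 3 → Bool}
    (hx : (Finset.univ.filter fun i => x i = true).card = 2) : fn2Weight q x = 0 :=
  pushWeight_eq_zero_of_forall_ne _ (pairProd_ne_of_weightTwo hx)

/-- Each coin outcome contributes its (positive) mass to its image: `coinWeight q y ≤ fn2Weight q (pairProd y)`.
[cite: Kahn2022, p. 2 footnote 2] -/
theorem coinWeight_le_fn2Weight {q : Fin 3 → ℝ} (hq : ∀ i, 0 ≤ q i ∧ q i ≤ 1) (y : Fin 3 → Bool) :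
    coinWeight q y ≤ fn2Weight q (pairProd y) :=
  le_pushWeight_apply (coinWeight_nonneg hq) _ _

/-- The string `100` (only `X_0 = Y_0Y_1` equal to `1`). [cite: Kahn2022, p. 2 footnote 2] -/
def x100 : Fin 3 → Bool := ![true, false, false]
/-- The string `010`. [cite: Kahn2022, p. 2 footnote 2] -/
def x010 : Fin 3 → Bool := ![false, true, false]
/-- The string `110` (weight two). [cite: Kahn2022, p. 2 footnote 2] -/
def x110 : Fin 3 → Bool := ![true, true, false]
/-- The string `000`. [cite: Kahn2022, p. 2 footnote 2] -/
def x000 : Fin 3 → Bool := ![false, false, false]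

/-- `100 = pairProd 110`, `010 = pairProd 101`; `100 ∧ 010 = 000`, `100 ∨ 010 = 110`, and `110` has weight two.
[cite: Kahn2022, p. 2 footnote 2] -/
theorem x_facts :
    pairProd ![true, true, false] = x100 ∧ pairProd ![true, false, true] = x010 ∧
      x100 ⊓ x010 = x000 ∧ x100 ⊔ x010 = x110 ∧
      (Finset.univ.filter fun i => x110 i = true).card = 2 := by
  refine ⟨by decide, by decide, ?_, ?_, by decide⟩
  · funext i; fin_cases i <;> rfl
  · funext i; fin_cases i <;> rfl

/-- With non-degenerate coins the strings `100` and `010` have positive probability.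
[cite: Kahn2022, p. 2 footnote 2] -/
theorem fn2Weight_pos {q : Fin 3 → ℝ} (hq : ∀ i, 0 < q i ∧ q i < 1) :
    0 < fn2Weight q x100 ∧ 0 < fn2Weight q x010 := by
  have hq' : ∀ i, 0 ≤ q i ∧ q i ≤ 1 := fun i => ⟨(hq i).1.le, (hq i).2.le⟩
  obtain ⟨h1, h2, -, -, -⟩ := x_facts
  exact ⟨h1 ▸ (coinWeight_pos hq _).trans_le (coinWeight_le_fn2Weight hq' _),
    h2 ▸ (coinWeight_pos hq _).trans_le (coinWeight_le_fn2Weight hq' _)⟩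

/-- **Kahn's footnote 2, "so trivially violates (1)"**: for non-degenerate coins the law of
`(Y_0Y_1, Y_0Y_2, Y_1Y_2)` violates the positive lattice condition — `µ(100)µ(010) > 0 = µ(000)µ(110)` — hence is
not an FKG probability weight (`IsFKGMeasure`, `Functional.lean`). [cite: Kahn2022, p. 2 footnote 2; p. 1 eq. (1)] -/
theorem not_isFKGMeasure_fn2Weight {q : Fin 3 → ℝ} (hq : ∀ i, 0 < q i ∧ q i < 1) :
    ¬ IsFKGMeasure (fn2Weight q) := by
  intro h
  obtain ⟨-, -, hinf, hsup, h110⟩ := x_facts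
  have hle := h.mul_le_mul x100 x010
  rw [hinf, hsup, fn2Weight_eq_zero_of_weightTwo q h110, mul_zero] at hle
  obtain ⟨h1, h2⟩ := fn2Weight_pos hq
  exact absurd hle (not_le.2 (mul_pos h1 h2))

/-- **Kahn 2022, footnote 2: FUI does not imply FKG** — in the vocabulary of "FKG measures are FUI"
(`IsFKGMeasure.exists_coinRepresentation_cube`), whose converse therefore fails: there is a probability weight on
the cube `{0,1}^3` which is the law `G_* (coinWeight q)` of a MONOTONE function `G` of finitely many independent
non-degenerate coins (FUI), yet is not an FKG weight.  Witness: fair coins and `G = pairProd`.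
[cite: Kahn2022, p. 2 footnote 2] -/
theorem kahn2022_fn2 :
    ∃ μ : (Fin 3 → Bool) → ℝ, (∀ x, 0 ≤ μ x) ∧ ∑ x, μ x = 1 ∧
      (∃ (m : ℕ) (q : Fin m → ℝ) (G : (Fin m → Bool) → (Fin 3 → Bool)),
        (∀ i, 0 < q i ∧ q i < 1) ∧ Monotone G ∧ μ = pushWeight (coinWeight q) G) ∧
      ¬ IsFKGMeasure μ := by
  have hq : ∀ i : Fin 3, 0 < (fun _ => (1/2 : ℝ)) i ∧ (fun _ => (1/2 : ℝ)) i < 1 := fun _ => by norm_num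
  exact ⟨fn2Weight fun _ => 1/2, fn2Weight_nonneg fun i => ⟨(hq i).1.le, (hq i).2.le⟩, sum_fn2Weight _,
    ⟨3, fun _ => 1/2, pairProd, hq, pairProd_mono, rfl⟩, not_isFKGMeasure_fn2Weight hq⟩

end Weight

/-! ### Measure level: `Set (Fin 3)` and `prodBernoulli` -/

section MeasureLevel

/-- **The map `Y ↦ X` on sets**: the set of indices `i` whose pair `{a_i, b_i}` is contained in the
open set `S` of coins. [cite: Kahn2022, p. 2 footnote 2] -/
def pairMap (S : Set (Fin 3)) : Set (Fin 3) := {i | (fn2Pair i).1 ∈ S ∧ (fn2Pair i).2 ∈ S}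

/-- `pairMap` is monotone. [cite: Kahn2022, p. 2 footnote 2] -/
theorem pairMap_mono : Monotone pairMap := fun _ _ h _ hi => ⟨h hi.1, h hi.2⟩

/-- **Harris' inequality as positive association of `prodBernoulli p`** (any index type, any parameters):
the tree's `prodBernoulli_harris` in the form `IsPositivelyAssociated`.  "FUI ⇒ PA" is then
`IsPositivelyAssociated.map`. [cite: Kahn2022, p. 2 ("realize the `X_i`'s as increasing functions of
independent Bernoullis … and invoke Harris")] -/
theorem isPositivelyAssociated_prodBernoulli {ι : Type*} (p : ι → unitInterval) :
    IsPositivelyAssociated (prodBernoulli p) :=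
  isPositivelyAssociated_of_real fun _ _ hA hB hAm hBm => prodBernoulli_harris p hA hB hAm hBm

/-- **The law of `(X_0, X_1, X_2)` as a measure**: the image of `prodBernoulli q` on `Set (Fin 3)` under
`pairMap` — an FUI measure in the sense of `kahn2022_cor4`. [cite: Kahn2022, p. 2 footnote 2] -/
def fn2Law (q : Fin 3 → unitInterval) : Measure (Set (Fin 3)) := (prodBernoulli q).map pairMap

/-- `fn2Law q` is a probability measure. [cite: Kahn2022, p. 2 footnote 2] -/
instance isProbabilityMeasure_fn2Law (q : Fin 3 → unitInterval) : IsProbabilityMeasure (fn2Law q) :=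
  isProbabilityMeasure_map (Measurable.of_discrete (f := pairMap)).aemeasurable

/-- **FUI ⇒ PA**: `fn2Law q` is positively associated (Harris for the coins, then the monotone image).
[cite: Kahn2022, p. 2 ("Underlying independents")] -/
theorem isPositivelyAssociated_fn2Law (q : Fin 3 → unitInterval) : IsPositivelyAssociated (fn2Law q) :=
  (isPositivelyAssociated_prodBernoulli q).map pairMap_mono Measurable.of_discrete

/-- Values of `fn2Law` as `prodBernoulli`-probabilities of preimages. [cite: Kahn2022, p. 2 footnote 2] -/
theorem fn2Law_real (q : Fin 3 → unitInterval) (𝒮 : Set (Set (Fin 3))) :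
    (fn2Law q).real 𝒮 = (prodBernoulli q).real (pairMap ⁻¹' 𝒮) := by
  rw [fn2Law, measureReal_def, measureReal_def, Measure.map_apply Measurable.of_discrete MeasurableSet.of_discrete]

/-- Two distinct indices in `pairMap S` force all three coins, hence all of `pairMap S`: the image never has
exactly two elements. [cite: Kahn2022, p. 2 footnote 2] -/
theorem pairMap_ne_pair (S : Set (Fin 3)) :
    pairMap S ≠ ({0, 1} : Set (Fin 3)) ∧ pairMap S ≠ ({0, 2} : Set (Fin 3)) ∧
      pairMap S ≠ ({1, 2} : Set (Fin 3)) := by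
  refine ⟨fun h => ?_, fun h => ?_, fun h => ?_⟩
  · have h0 : (0 : Fin 3) ∈ pairMap S := by rw [h]; simp
    have h1 : (1 : Fin 3) ∈ pairMap S := by rw [h]; simp
    have h2 : (2 : Fin 3) ∈ pairMap S := ⟨h0.2, h1.2⟩
    rw [h] at h2
    exact absurd h2 (by decide)
  · have h0 : (0 : Fin 3) ∈ pairMap S := by rw [h]; simp
    have h2 : (2 : Fin 3) ∈ pairMap S := by rw [h]; simp
    have h1 : (1 : Fin 3) ∈ pairMap S := ⟨h0.1, h2.2⟩
    rw [h] at h1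
    exact absurd h1 (by decide)
  · have h1 : (1 : Fin 3) ∈ pairMap S := by rw [h]; simp
    have h2 : (2 : Fin 3) ∈ pairMap S := by rw [h]; simp
    have h0 : (0 : Fin 3) ∈ pairMap S := ⟨h1.1, h2.1⟩
    rw [h] at h0
    exact absurd h0 (by decide)

/-- **"Probability zero to strings of weight 2"**, measure form: the three 2-sets are `fn2Law`-null.
[cite: Kahn2022, p. 2 footnote 2] -/
theorem fn2Law_real_pair_eq_zero (q : Fin 3 → unitInterval) :
    (fn2Law q).real {({0, 1} : Set (Fin 3))} = 0 ∧ (fn2Law q).real {({0, 2} : Set (Fin 3))} = 0 ∧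
      (fn2Law q).real {({1, 2} : Set (Fin 3))} = 0 := by
  have e : ∀ T : Set (Fin 3), (∀ S, pairMap S ≠ T) → (fn2Law q).real {T} = 0 := fun T hT => by
    rw [fn2Law_real]
    have : pairMap ⁻¹' ({T} : Set (Set (Fin 3))) = ∅ :=
      Set.eq_empty_iff_forall_notMem.2 fun S hS => hT S hS
    rw [this, measureReal_empty]
  exact ⟨e _ fun S => (pairMap_ne_pair S).1, e _ fun S => (pairMap_ne_pair S).2.1,
    e _ fun S => (pairMap_ne_pair S).2.2⟩

/-- `pairMap {0,1} = {0}` and `pairMap {0,2} = {1}`: the singletons `{0}`, `{1}` are hit.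
[cite: Kahn2022, p. 2 footnote 2] -/
theorem pairMap_pair : pairMap ({0, 1} : Set (Fin 3)) = {0} ∧ pairMap ({0, 2} : Set (Fin 3)) = {1} := by
  constructor
  · ext i; fin_cases i <;> simp [pairMap]
  · ext i; fin_cases i <;> simp [pairMap]

/-- With non-degenerate coins the singletons `{0}` and `{1}` have positive `fn2Law`-probability.
[cite: Kahn2022, p. 2 footnote 2] -/
theorem fn2Law_real_singleton_pos {q : Fin 3 → unitInterval} (hq : ∀ i, 0 < q i ∧ q i < 1) :
    0 < (fn2Law q).real {({0} : Set (Fin 3))} ∧ 0 < (fn2Law q).real {({1} : Set (Fin 3))} := by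
  obtain ⟨h01, h02⟩ := pairMap_pair
  have e : ∀ S : Set (Fin 3), 0 < (fn2Law q).real {pairMap S} := fun S => by
    rw [fn2Law_real]
    refine (prodBernoulli_real_pos_of_nonempty hq (Set.singleton_nonempty S)).trans_le ?_
    exact measureReal_mono (fun T hT => by rw [Set.mem_singleton_iff.1 hT]; rfl) (measure_ne_top _ _)
  exact ⟨h01 ▸ e _, h02 ▸ e _⟩

/-- **Kahn's footnote 2, "so trivially violates (1)"**, measure form: for non-degenerate coins the point
weights `S ↦ fn2Law q {S}` violate the positive lattice condition on `2^{[3]}` —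
`µ({0})µ({1}) > 0 = µ(∅)µ({0,1})` — so they are not an FKG probability weight.
[cite: Kahn2022, p. 2 footnote 2; p. 1 eq. (1)] -/
theorem not_isFKGMeasure_fn2Law {q : Fin 3 → unitInterval} (hq : ∀ i, 0 < q i ∧ q i < 1) :
    ¬ IsFKGMeasure (fun S : Set (Fin 3) => (fn2Law q).real {S}) := by
  intro h
  have hle := h.mul_le_mul {0} {1}
  have hsup : (({0} : Set (Fin 3)) ⊔ ({1} : Set (Fin 3))) = ({0, 1} : Set (Fin 3)) := Set.singleton_union
  simp only [hsup, (fn2Law_real_pair_eq_zero q).1, mul_zero] at hle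
  obtain ⟨h0, h1⟩ := fn2Law_real_singleton_pos hq
  exact absurd hle (not_le.2 (mul_pos h0 h1))

/-- **Kahn 2022, footnote 2: FUI does not imply FKG** — measure form, the companion of Corollary 4
(`kahn2022_cor4`: PA ⇏ FUI).  There is a probability measure on `2^{[3]}` which IS the image of a
non-degenerate product measure on finitely many coins under a monotone map (FUI) — hence positively
associated — but whose point weights violate the FKG lattice condition.  Witness: fair coins on `Fin 3` and
`pairMap`.  So both inclusions FKG ⊊ FUI ⊊ PA are strict. [cite: Kahn2022, p. 2 footnote 2] -/
theorem kahn2022_fn2_measure :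
    ∃ μ : Measure (Set (Fin 3)), IsProbabilityMeasure μ ∧ IsPositivelyAssociated μ ∧
      (∃ (κ : Type) (_ : Fintype κ) (q : κ → unitInterval) (Φ : Set κ → Set (Fin 3)),
        (∀ k, 0 < q k ∧ q k < 1) ∧ Monotone Φ ∧ μ = (prodBernoulli q).map Φ) ∧
      ¬ IsFKGMeasure (fun S : Set (Fin 3) => μ.real {S}) := by
  let half : unitInterval := ⟨1/2, by norm_num, by norm_num⟩
  have hq : ∀ i : Fin 3, 0 < (fun _ => half) i ∧ (fun _ => half) i < 1 := fun _ =>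
    ⟨Subtype.mk_lt_mk.2 (by norm_num), Subtype.mk_lt_mk.2 (by norm_num)⟩
  exact ⟨fn2Law fun _ => half, inferInstance, isPositivelyAssociated_fn2Law _,
    ⟨Fin 3, inferInstance, fun _ => half, pairMap, hq, pairMap_mono, rfl⟩, not_isFKGMeasure_fn2Law hq⟩

end MeasureLevel

end Kahn2022

end Literature.Combinatorics.Sahi2008
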